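import Literature.AlgebraicGeometry.ComplexMultiplication.CyclotomicFermatCMTypesTwoPowerLevelCoincidences
import HarnessLib

/-!
# Koblitz–Rohrlich, THEOREM 4 (`N = 2ⁿ`), "Furthermore, a lattice of type a)ₘ is isogenous to the product of two lattices of type e)ₘ₊₁":
# `H_{(2ᵐ, 2ⁿ⁻¹−2ᵐ⁺¹, 2ⁿ⁻¹+2ᵐ)} = H_{(2ᵐ⁺¹, 2ⁿ⁻¹, 2ⁿ⁻¹−2ᵐ⁺¹)}` for EVERY `n ≥ 3`

Layer `Literature/AlgebraicGeometry/ComplexMultiplication`, namespace `…ComplexMultiplication.CyclotomicFermatCMType`; sequel of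
`CyclotomicFermatCMTypesTwoPowerLevelCoincidences` (families d), e) for every `n`) and `CyclotomicFermatCMTypesTwoPowerLevelIsogenies` (the
`N = 8, 16` members `H_{(1,2,5)} = H_{(2,2,4)}`, `H_{(1,6,9)} = H_{(2,8,6)}` by kernel enumeration).  THEOREMS ONLY (no definition, no named
fact, no `sorry`); no kernel `decide`.

THE SOURCE.  N. Koblitz, D. Rohrlich, *Simple factors in the Jacobian of a Fermat curve*, Canad. J. Math. **30** (1978) 1183–1205, p. 1186,
Theorem 4: "a) `(2ᵐ, 2ⁿ⁻¹ − 2ᵐ⁺¹, 2ⁿ⁻¹ + 2ᵐ)` and … for `0 ≤ m ≤ n − 3`, … e) `(2ᵐ, 2ⁿ⁻¹, 2ⁿ⁻¹ − 2ᵐ)` and `(2ᵐ, 2ᵐ, 2ⁿ − 2ᵐ⁺¹)` for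
`0 ≤ m ≤ n − 2`.  Furthermore, a lattice of type a)ₘ is isogenous to the product of two lattices of type e)ₘ₊₁."  In the residue-set language
of §1 (p. 1184; the type e)ₘ₊₁ triple `(2ᵐ⁺¹, 2ⁿ⁻¹, 2ⁿ⁻¹ − 2ᵐ⁺¹)` has g.c.d. `2ᵐ⁺¹`, so its lattice lives at level `2^{n−m−1}` and has half
the dimension of the a)ₘ lattice): `H_{(2ᵐ, 2ⁿ⁻¹−2ᵐ⁺¹, 2ⁿ⁻¹+2ᵐ)} = H_{(2ᵐ⁺¹, 2ⁿ⁻¹, 2ⁿ⁻¹−2ᵐ⁺¹)}` in `(ℤ/2ⁿ)ˣ` (the sibling's `N = 16` member: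
`H_{(1,6,9)} = H_{(2,8,6)}`).

WHAT IS PROVED — this equality of residue sets FOR EVERY `n ≥ 3` (`m = 0`, §2) and its pull-backs for `0 ≤ m ≤ n − 3` (§3), from the
identity `x + ⟨(T+1)x⟩ = ⟨2x⟩ + ⟨Tx⟩` modulo `2T` for odd `x` (§1; two cases `x <> T`; the residue `⟨(T−2)x⟩` is common to both sides);
instance `N = 64`: `H_{(1,30,33)} = H_{(2,32,30)}`.  §4: the same with the SECOND e)ₘ₊₁ triple `(2ᵐ⁺¹, 2ᵐ⁺¹, 2ⁿ − 2ᵐ⁺²)` —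
`H_{(1, 2ⁿ⁻¹−2, 2ⁿ⁻¹+1)} = H_{(2, 2, 2ⁿ−4)}` for every `n ≥ 3` (the sibling's e) family at `m = 1`, transported to the level `2ⁿ`, composed
with §2), its pull-backs, and `N = 64`: `H_{(1,30,33)} = H_{(2,2,60)}` — so the a)ₘ triple has the common CM type of both e)ₘ₊₁ triples.
§5: these coincidences are NOT obvious (p. 1185: no unit multiple of a permutation) — by parity, in both directions, for every `n ≥ 3`.

## Honest column / NOT here

* The isogeny of LATTICES "`L_{a)ₘ} ∼ L_{e)ₘ₊₁} × L_{e)ₘ₊₁}`" (different levels and dimensions) is not constructed; typed is the equality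
  of the residue sets at level `2ⁿ`, i.e. the equality of the CM types of `ℚ(ζ_{2ⁿ})` they cut out (as in all siblings).
* The identity of §1 is ours.  Whether a)ₘ's own pair is "obvious" is discussed in the siblings' honest columns and not here.

## References

* [KoblitzRohrlich1978] N. Koblitz, D. Rohrlich, Canad. J. Math. 30 (1978) 1183–1205: Theorem 4 (p. 1186), §1 (pp. 1184–1185).

## Provenance

Cell `pub-hodgecm2` (COR-CM), literature seat `lit-deligne-3` gen 36 (claim KR78-THM4-FURTHERMORE; count-neutral, own lane).
-/

open NumberField

namespace Literature.AlgebraicGeometry.ComplexMultiplication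

open Literature.AlgebraicGeometry.HodgeTheory

namespace CyclotomicFermatCMType

/-! ## §1 The residue identity `x + ⟨(T+1)x⟩ = ⟨2x⟩ + ⟨Tx⟩` modulo `2T` for odd `x` -/

section Residues

/-- `y % m = r` from `r + m·q = y`, `r < m` (private copy). [folklore] -/
private theorem mod_eq_of_add_mul_eq₃ {m r q y : ℕ} (hm : 0 < m) (h : r + m * q = y) (hr : r < m) : y % m = r :=
  ((Nat.div_mod_unique hm).2 ⟨h, hr⟩).2

/-- `(b·n + r) % n = r % n` (private copy). [folklore] -/
private theorem mul_add_mod_right₃ (b n r : ℕ) : (b * n + r) % n = r % n := by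
  rw [Nat.add_comm, Nat.add_mul_mod_self_right]

/-- **The identity behind "a)ₘ ∼ e)ₘ₊₁ × e)ₘ₊₁"**: for `T ≥ 1` and odd `x < 2T`, `x + (x(T + 1) mod 2T) = (2x mod 2T) + (xT mod 2T)`
(both sides are `2x + T` for `x < T` and `2x − T` for `x > T`). [cite: KoblitzRohrlich1978, Theorem 4 (p. 1186)] -/
theorem add_mul_succ_mod_eq {T x : ℕ} (hT0 : 0 < T) (hx2 : x % 2 = 1) (hx : x < 2 * T) :
    x + (x * (T + 1)) % (2 * T) = (2 * x) % (2 * T) + (x * T) % (2 * T) := by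
  have hpos : 0 < 2 * T := by omega
  set a := x / 2 with ha
  have hxe : x = 2 * a + 1 := by omega
  have e1 : x * (T + 1) = a * (2 * T) + (T + x) := by
    rw [hxe]
    ring
  rw [mul_mod_two_mul_of_odd hT0 hx2]
  rcases Nat.lt_or_ge x T with h1 | h1
  · -- `x < T`
    have mA : (x * (T + 1)) % (2 * T) = T + x := by
      rw [e1, mul_add_mod_right₃]
      exact Nat.mod_eq_of_lt (by omega)
    rw [mA, Nat.mod_eq_of_lt (by omega : 2 * x < 2 * T)]
    omega
  · -- `T ≤ x < 2T` (in fact `x > T`, `x` being odd is irrelevant here)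
    have mA : (x * (T + 1)) % (2 * T) = x - T := by
      rw [e1, mul_add_mod_right₃]
      exact mod_eq_of_add_mul_eq₃ hpos (q := 1) (by omega) (by omega)
    have m2 : (2 * x) % (2 * T) = 2 * x - 2 * T := mod_eq_of_add_mul_eq₃ hpos (q := 1) (by omega) (by omega)
    rw [mA, m2]
    omega

end Residues

/-! ## §2 `H_{(1, 2ⁿ⁻¹ − 2, 2ⁿ⁻¹ + 1)} = H_{(2, 2ⁿ⁻¹, 2ⁿ⁻¹ − 2)}` for every `n ≥ 3` -/

section Furthermore

variable {n : ℕ}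

/-- A unit modulo `2ⁿ` (`n ≥ 1`) has odd `val` (private copy). [folklore] -/
private theorem val_mod_two_of_coprime₃ (hn : 1 ≤ n) {x : ZMod (2 ^ n)} (hx : x.val.Coprime (2 ^ n)) : x.val % 2 = 1 := by
  by_contra h0
  have h2 : 2 ∣ Nat.gcd x.val (2 ^ n) := Nat.dvd_gcd (Nat.dvd_of_mod_eq_zero (by omega)) (dvd_pow_self 2 (by omega))
  rw [hx] at h2
  exact absurd (Nat.le_of_dvd one_pos h2) (by norm_num)

/-- **The residues**: for `n ≥ 3` and every unit `x` modulo `2ⁿ`,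
`⟨x⟩ + ⟨(2ⁿ⁻¹ − 2)x⟩ + ⟨(2ⁿ⁻¹ + 1)x⟩ = ⟨2x⟩ + ⟨2ⁿ⁻¹x⟩ + ⟨(2ⁿ⁻¹ − 2)x⟩`. [cite: KoblitzRohrlich1978, Theorem 4 (p. 1186)] -/
theorem val_sum_eq_furthermore [NeZero (2 ^ n)] (hn : 3 ≤ n) (x : ZMod (2 ^ n)) (hx : x.val.Coprime (2 ^ n)) :
    (x * 1).val + (x * ((2 ^ (n - 1) - 2 : ℕ) : ZMod (2 ^ n))).val + (x * ((2 ^ (n - 1) + 1 : ℕ) : ZMod (2 ^ n))).val =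
      (x * 2).val + (x * ((2 ^ (n - 1) : ℕ) : ZMod (2 ^ n))).val + (x * ((2 ^ (n - 1) - 2 : ℕ) : ZMod (2 ^ n))).val := by
  set T := 2 ^ (n - 1) with hT
  have hN : 2 ^ n = 2 * T := by
    rw [hT, ← pow_succ']
    congr 1
    omega
  have hT4 : 4 ≤ T := by
    rw [hT]
    calc 4 = 2 ^ 2 := by norm_num
      _ ≤ 2 ^ (n - 1) := Nat.pow_le_pow_right (by norm_num) (by omega)
  have hodd := val_mod_two_of_coprime₃ (by omega) hx
  have hlt1 : T - 2 < 2 ^ n := by omega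
  have hlt2 : T + 1 < 2 ^ n := by omega
  have hlt3 : T < 2 ^ n := by omega
  have hxlt : x.val < 2 ^ n := ZMod.val_lt x
  have h2 : (2 : ZMod (2 ^ n)) = ((2 : ℕ) : ZMod (2 ^ n)) := (Nat.cast_ofNat).symm
  rw [h2]
  simp only [mul_one, ZMod.val_mul, ZMod.val_natCast, Nat.mod_eq_of_lt hlt1, Nat.mod_eq_of_lt hlt2, Nat.mod_eq_of_lt hlt3,
    Nat.mod_eq_of_lt (show 2 < 2 ^ n by omega)]
  set X := x.val with hX
  rw [hN] at hxlt ⊢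
  have key := add_mul_succ_mod_eq (T := T) (by omega) hodd hxlt
  rw [mul_comm X 2]
  omega

/-- **THEOREM 4, "Furthermore", EVERY `n ≥ 3`** (`m = 0`): `H_{(1, 2ⁿ⁻¹ − 2, 2ⁿ⁻¹ + 1)} = H_{(2, 2ⁿ⁻¹, 2ⁿ⁻¹ − 2)}` as residue sets modulo
`2ⁿ` — the type a)₀ lattice `L_{(1, 2ⁿ⁻¹−2, 2ⁿ⁻¹+1)}` has the CM type of `(2, 2ⁿ⁻¹, 2ⁿ⁻¹−2) = 2·(1, 2ⁿ⁻², 2ⁿ⁻²−1)`, the type e)₁ triple.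
[cite: KoblitzRohrlich1978, Theorem 4 (p. 1186) and §1 (p. 1184)] -/
theorem fermatCMType_twoPow_furthermore_eq [NeZero (2 ^ n)] (hn : 3 ≤ n) :
    fermatCMType (2 ^ n) 1 ((2 ^ (n - 1) - 2 : ℕ) : ZMod (2 ^ n)) ((2 ^ (n - 1) + 1 : ℕ) : ZMod (2 ^ n)) =
      fermatCMType (2 ^ n) 2 ((2 ^ (n - 1) : ℕ) : ZMod (2 ^ n)) ((2 ^ (n - 1) - 2 : ℕ) : ZMod (2 ^ n)) := by
  ext x
  simp only [fermatCMType, Finset.mem_filter, Finset.mem_univ, true_and]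
  constructor
  · rintro ⟨hc, hs⟩
    exact ⟨hc, by rw [← val_sum_eq_furthermore hn x hc]; exact hs⟩
  · rintro ⟨hc, hs⟩
    exact ⟨hc, by rw [val_sum_eq_furthermore hn x hc]; exact hs⟩

/-- **`N = 64`** (`n = 6`): `H_{(1, 30, 33)} = H_{(2, 32, 30)}` — beyond the sibling's kernel enumerations (`N ≤ 32`).
[cite: KoblitzRohrlich1978, Theorem 4 (p. 1186)] -/
theorem fermatCMType_sixtyFour_furthermore : fermatCMType 64 1 30 33 = fermatCMType 64 2 32 30 := by
  have h := fermatCMType_twoPow_furthermore_eq (n := 6) (by norm_num)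
  norm_num at h
  exact h

end Furthermore

/-! ## §3 The pairs a)ₘ, e)ₘ₊₁ with `m ≥ 1`: pull-backs from level `2^{n−m}` -/

section Scaled

variable {n m : ℕ}

/-- **THEOREM 4, "Furthermore", EVERY `n` and `0 ≤ m ≤ n − 3`** (level written `2ᵐ·2^{n−m} = 2ⁿ`; a)ₘ's first triple
`(2ᵐ, 2ⁿ⁻¹ − 2ᵐ⁺¹, 2ⁿ⁻¹ + 2ᵐ) = 2ᵐ·(1, 2^{n−m−1} − 2, 2^{n−m−1} + 1)` and e)ₘ₊₁'s `(2ᵐ⁺¹, 2ⁿ⁻¹, 2ⁿ⁻¹ − 2ᵐ⁺¹) = 2ᵐ·(2, 2^{n−m−1}, 2^{n−m−1} − 2)`):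
the two residue sets coincide. [cite: KoblitzRohrlich1978, Theorem 4 (p. 1186) and §1 (p. 1184)] -/
theorem fermatCMType_twoPow_furthermore_eq_scaled [NeZero (2 ^ (n - m))] [NeZero (2 ^ m * 2 ^ (n - m))] (hmn : m + 3 ≤ n) :
    fermatCMType (2 ^ m * 2 ^ (n - m)) ((2 ^ m * 1 : ℕ) : ZMod (2 ^ m * 2 ^ (n - m)))
        ((2 ^ m * (2 ^ (n - m - 1) - 2) : ℕ) : ZMod (2 ^ m * 2 ^ (n - m))) ((2 ^ m * (2 ^ (n - m - 1) + 1) : ℕ) : ZMod (2 ^ m * 2 ^ (n - m))) =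
      fermatCMType (2 ^ m * 2 ^ (n - m)) ((2 ^ m * 2 : ℕ) : ZMod (2 ^ m * 2 ^ (n - m)))
        ((2 ^ m * 2 ^ (n - m - 1) : ℕ) : ZMod (2 ^ m * 2 ^ (n - m))) ((2 ^ m * (2 ^ (n - m - 1) - 2) : ℕ) : ZMod (2 ^ m * 2 ^ (n - m))) := by
  have h := fermatCMType_twoPow_furthermore_eq (n := n - m) (by omega)
  refine fermatCMType_level_mul_eq_of_eq (pow_pos (by norm_num : 0 < 2) m) ?_
  simpa only [Nat.cast_one, Nat.cast_ofNat] using h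

end Scaled

/-! ## §4 «… the product of TWO lattices of type e)ₘ₊₁»: also `H_{(1, 2ⁿ⁻¹ − 2, 2ⁿ⁻¹ + 1)} = H_{(2, 2, 2ⁿ − 4)}`, the second e)₁ triple -/

section SecondFactor

variable {n m : ℕ}

/-- Transport of an equality of residue sets of `ℕ`-triples along an equality of levels (private). [folklore] -/
private theorem fermatCMType_natCast_eq_transport {N N' : ℕ} [NeZero N] [NeZero N'] (hN : N = N') {a b c a' b' c' : ℕ}
    (h : fermatCMType N' (a : ZMod N') (b : ZMod N') (c : ZMod N') = fermatCMType N' (a' : ZMod N') (b' : ZMod N') (c' : ZMod N')) :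
    fermatCMType N (a : ZMod N) (b : ZMod N) (c : ZMod N) = fermatCMType N (a' : ZMod N) (b' : ZMod N) (c' : ZMod N) := by
  subst hN
  exact h

/-- **Family e)₁ at level `2ⁿ`** (`n ≥ 3`): `H_{(2, 2ⁿ⁻¹, 2ⁿ⁻¹ − 2)} = H_{(2, 2, 2ⁿ − 4)}` — the sibling's `fermatCMType_twoPow_e_eq_scaled` at `m = 1`
(level written `2¹·2ⁿ⁻¹`) transported to the level `2ⁿ`. [cite: KoblitzRohrlich1978, Theorem 4 e) (p. 1186)] -/
theorem fermatCMType_twoPow_e_one_eq [NeZero (2 ^ n)] (hn : 3 ≤ n) :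
    fermatCMType (2 ^ n) 2 ((2 ^ (n - 1) : ℕ) : ZMod (2 ^ n)) ((2 ^ (n - 1) - 2 : ℕ) : ZMod (2 ^ n)) =
      fermatCMType (2 ^ n) 2 2 ((2 ^ n - 4 : ℕ) : ZMod (2 ^ n)) := by
  haveI : NeZero (2 ^ (n - 1)) := ⟨by positivity⟩
  haveI : NeZero (2 ^ 1 * 2 ^ (n - 1)) := ⟨by positivity⟩
  have h := fermatCMType_twoPow_e_eq_scaled (n := n) (m := 1) (by omega)
  have hN : 2 ^ n = 2 ^ 1 * 2 ^ (n - 1) := by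
    rw [← pow_add]
    congr 1
    omega
  have hA1 : 2 ^ (n - 1) = 2 * 2 ^ (n - 2) := by
    rw [← pow_succ']
    congr 1
    omega
  have hA2 : 2 ^ n = 2 * 2 ^ (n - 1) := by
    rw [← pow_succ']
    congr 1
    omega
  have hn2 : n - 1 - 1 = n - 2 := by omega
  have e1 : 2 ^ 1 * 1 = 2 := by norm_num
  have e2 : 2 ^ 1 * 2 ^ (n - 1 - 1) = 2 ^ (n - 1) := by rw [hn2, hA1, pow_one]
  have e3 : 2 ^ 1 * (2 ^ (n - 1 - 1) - 1) = 2 ^ (n - 1) - 2 := by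
    rw [hn2, hA1, pow_one]
    omega
  have e4 : 2 ^ 1 * (2 ^ (n - 1) - 2) = 2 ^ n - 4 := by
    rw [hA2, pow_one]
    omega
  have h' := fermatCMType_natCast_eq_transport hN h
  rw [e1, e2, e3, e4] at h'
  simpa only [Nat.cast_ofNat] using h'

/-- **THEOREM 4, "Furthermore", the SECOND factor, EVERY `n ≥ 3`** (`m = 0`): `H_{(1, 2ⁿ⁻¹ − 2, 2ⁿ⁻¹ + 1)} = H_{(2, 2, 2ⁿ − 4)}` modulo `2ⁿ` —
together with `fermatCMType_twoPow_furthermore_eq`: the type a)₀ triple has the common CM type of BOTH e)₁ triples `(2, 2ⁿ⁻¹, 2ⁿ⁻¹ − 2)`,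
`(2, 2, 2ⁿ − 4)` («isogenous to the product of two lattices of type e)ₘ₊₁»; sibling's `N = 16` member `H_{(1,6,9)} = H_{(2,2,12)}`).
[cite: KoblitzRohrlich1978, Theorem 4 (p. 1186) and §1 (p. 1184)] -/
theorem fermatCMType_twoPow_furthermore_snd_eq [NeZero (2 ^ n)] (hn : 3 ≤ n) :
    fermatCMType (2 ^ n) 1 ((2 ^ (n - 1) - 2 : ℕ) : ZMod (2 ^ n)) ((2 ^ (n - 1) + 1 : ℕ) : ZMod (2 ^ n)) =
      fermatCMType (2 ^ n) 2 2 ((2 ^ n - 4 : ℕ) : ZMod (2 ^ n)) :=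
  (fermatCMType_twoPow_furthermore_eq hn).trans (fermatCMType_twoPow_e_one_eq hn)

/-- **`N = 64`** (`n = 6`): `H_{(1, 30, 33)} = H_{(2, 2, 60)}`. [cite: KoblitzRohrlich1978, Theorem 4 (p. 1186)] -/
theorem fermatCMType_sixtyFour_furthermore_snd : fermatCMType 64 1 30 33 = fermatCMType 64 2 2 60 := by
  have h := fermatCMType_twoPow_furthermore_snd_eq (n := 6) (by norm_num)
  norm_num at h
  exact h

/-- **THEOREM 4, "Furthermore", the second factor for `0 ≤ m ≤ n − 3`** (level written `2ᵐ·2^{n−m} = 2ⁿ`; a)ₘ's first triple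
`2ᵐ·(1, 2^{n−m−1} − 2, 2^{n−m−1} + 1)` and e)ₘ₊₁'s second triple `(2ᵐ⁺¹, 2ᵐ⁺¹, 2ⁿ − 2ᵐ⁺²) = 2ᵐ·(2, 2, 2^{n−m} − 4)`): the two residue
sets coincide. [cite: KoblitzRohrlich1978, Theorem 4 (p. 1186) and §1 (p. 1184)] -/
theorem fermatCMType_twoPow_furthermore_snd_eq_scaled [NeZero (2 ^ (n - m))] [NeZero (2 ^ m * 2 ^ (n - m))] (hmn : m + 3 ≤ n) :
    fermatCMType (2 ^ m * 2 ^ (n - m)) ((2 ^ m * 1 : ℕ) : ZMod (2 ^ m * 2 ^ (n - m)))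
        ((2 ^ m * (2 ^ (n - m - 1) - 2) : ℕ) : ZMod (2 ^ m * 2 ^ (n - m))) ((2 ^ m * (2 ^ (n - m - 1) + 1) : ℕ) : ZMod (2 ^ m * 2 ^ (n - m))) =
      fermatCMType (2 ^ m * 2 ^ (n - m)) ((2 ^ m * 2 : ℕ) : ZMod (2 ^ m * 2 ^ (n - m)))
        ((2 ^ m * 2 : ℕ) : ZMod (2 ^ m * 2 ^ (n - m))) ((2 ^ m * (2 ^ (n - m) - 4) : ℕ) : ZMod (2 ^ m * 2 ^ (n - m))) := by
  have h := fermatCMType_twoPow_furthermore_snd_eq (n := n - m) (by omega)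
  refine fermatCMType_level_mul_eq_of_eq (pow_pos (by norm_num : 0 < 2) m) ?_
  simpa only [Nat.cast_one, Nat.cast_ofNat] using h

end SecondFactor

/-! ## §5 «apart from the obvious ones»: the coincidences of §2 and §4 are not equivalences of triples (parity) -/

section NotObvious

variable {n : ℕ}

/-- `1 ≠ u·k` modulo `2ⁿ` (`n ≥ 1`) for even `k` (private). [folklore] -/
private theorem one_ne_mul_natCast_of_two_dvd (hn : 1 ≤ n) (u : ZMod (2 ^ n)) {k : ℕ} (hk : 2 ∣ k) :
    (1 : ZMod (2 ^ n)) ≠ u * (k : ZMod (2 ^ n)) := by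
  intro h
  have h2n : 2 ∣ 2 ^ n := dvd_pow_self 2 (by omega)
  have h2le : 2 ≤ 2 ^ n := by
    calc (2 : ℕ) = 2 ^ 1 := by norm_num
      _ ≤ 2 ^ n := Nat.pow_le_pow_right (by norm_num) hn
  have hv := congrArg ZMod.val h
  rw [ZMod.val_one_eq_one_mod, Nat.mod_eq_of_lt (by omega : 1 < 2 ^ n), ZMod.val_mul, ZMod.val_natCast] at hv
  have h2 : 2 ∣ (u.val * (k % 2 ^ n)) % 2 ^ n := (Nat.dvd_mod_iff h2n).2 (dvd_mul_of_dvd_right ((Nat.dvd_mod_iff h2n).2 hk) _)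
  omega

/-- A residue equal to the class of an even number modulo `2ⁿ` (`n ≥ 1`) is not a unit (private). [folklore] -/
private theorem not_coprime_of_eq_natCast_of_two_dvd (hn : 1 ≤ n) {u : ZMod (2 ^ n)} {k : ℕ} (hk : 2 ∣ k) (h : u = (k : ZMod (2 ^ n))) :
    ¬u.val.Coprime (2 ^ n) := by
  intro hu
  have h2n : 2 ∣ 2 ^ n := dvd_pow_self 2 (by omega)
  have h2u : 2 ∣ u.val := by
    rw [h, ZMod.val_natCast]
    exact (Nat.dvd_mod_iff h2n).2 hk
  have h2 : 2 ∣ Nat.gcd u.val (2 ^ n) := Nat.dvd_gcd h2u h2n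
  rw [hu] at h2
  exact absurd (Nat.le_of_dvd one_pos h2) (by norm_num)

/-- **The coincidence of §2 is NOT obvious, every `n ≥ 3`**: `(1, 2ⁿ⁻¹ − 2, 2ⁿ⁻¹ + 1)` is no multiple `u·(2, 2ⁿ⁻¹, 2ⁿ⁻¹ − 2)` of a permutation
modulo `2ⁿ` (the entry `1` is odd, every `u·(even)` is even). [cite: KoblitzRohrlich1978, Theorem 4 (p. 1186) and §1 (p. 1185)] -/
theorem not_exists_multiset_eq_twoPow_furthermore (hn : 3 ≤ n) :
    ¬∃ u : ZMod (2 ^ n), ({1, ((2 ^ (n - 1) - 2 : ℕ) : ZMod (2 ^ n)), ((2 ^ (n - 1) + 1 : ℕ) : ZMod (2 ^ n))} : Multiset (ZMod (2 ^ n))) =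
      {u * 2, u * ((2 ^ (n - 1) : ℕ) : ZMod (2 ^ n)), u * ((2 ^ (n - 1) - 2 : ℕ) : ZMod (2 ^ n))} := by
  rintro ⟨u, hu⟩
  have hT : 2 ∣ 2 ^ (n - 1) := dvd_pow_self 2 (by omega)
  have hT2 : 2 ∣ 2 ^ (n - 1) - 2 := Nat.dvd_sub hT (dvd_refl 2)
  have h2 : (2 : ZMod (2 ^ n)) = ((2 : ℕ) : ZMod (2 ^ n)) := (Nat.cast_ofNat).symm
  have h1 : (1 : ZMod (2 ^ n)) ∈
      ({u * 2, u * ((2 ^ (n - 1) : ℕ) : ZMod (2 ^ n)), u * ((2 ^ (n - 1) - 2 : ℕ) : ZMod (2 ^ n))} : Multiset (ZMod (2 ^ n))) := by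
    rw [← hu]
    simp
  simp only [Multiset.insert_eq_cons, Multiset.mem_cons, Multiset.mem_singleton] at h1
  rcases h1 with e | e | e
  · rw [h2] at e
    exact one_ne_mul_natCast_of_two_dvd (by omega) u (dvd_refl 2) e
  · exact one_ne_mul_natCast_of_two_dvd (by omega) u hT e
  · exact one_ne_mul_natCast_of_two_dvd (by omega) u hT2 e

/-- **The coincidence of §4 is NOT obvious, every `n ≥ 3`**: `(1, 2ⁿ⁻¹ − 2, 2ⁿ⁻¹ + 1)` is no multiple `u·(2, 2, 2ⁿ − 4)` of a permutation
modulo `2ⁿ`. [cite: KoblitzRohrlich1978, Theorem 4 (p. 1186) and §1 (p. 1185)] -/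
theorem not_exists_multiset_eq_twoPow_furthermore_snd (hn : 3 ≤ n) :
    ¬∃ u : ZMod (2 ^ n), ({1, ((2 ^ (n - 1) - 2 : ℕ) : ZMod (2 ^ n)), ((2 ^ (n - 1) + 1 : ℕ) : ZMod (2 ^ n))} : Multiset (ZMod (2 ^ n))) =
      {u * 2, u * 2, u * ((2 ^ n - 4 : ℕ) : ZMod (2 ^ n))} := by
  rintro ⟨u, hu⟩
  have hN4 : 2 ∣ 2 ^ n - 4 := Nat.dvd_sub (dvd_pow_self 2 (by omega)) (by norm_num)
  have h2 : (2 : ZMod (2 ^ n)) = ((2 : ℕ) : ZMod (2 ^ n)) := (Nat.cast_ofNat).symm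
  have h1 : (1 : ZMod (2 ^ n)) ∈ ({u * 2, u * 2, u * ((2 ^ n - 4 : ℕ) : ZMod (2 ^ n))} : Multiset (ZMod (2 ^ n))) := by
    rw [← hu]
    simp
  simp only [Multiset.insert_eq_cons, Multiset.mem_cons, Multiset.mem_singleton] at h1
  rcases h1 with e | e | e
  · rw [h2] at e
    exact one_ne_mul_natCast_of_two_dvd (by omega) u (dvd_refl 2) e
  · rw [h2] at e
    exact one_ne_mul_natCast_of_two_dvd (by omega) u (dvd_refl 2) e
  · exact one_ne_mul_natCast_of_two_dvd (by omega) u hN4 e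

/-- **… nor in the other direction** (K–R's `τ ∼ τ′`: `{τ′} = {hτ}` for a UNIT `h`, p. 1185): no unit `u` modulo `2ⁿ` (`n ≥ 2`) has
`{2, 2ⁿ⁻¹, 2ⁿ⁻¹ − 2} = {u·1, u·(2ⁿ⁻¹ − 2), u·(2ⁿ⁻¹ + 1)}` — `u = u·1` would be even.  (Without the unit hypothesis this fails at `n = 3`:
`2·(1, 2, 5) = (2, 4, 2)`.) [cite: KoblitzRohrlich1978, Theorem 4 (p. 1186) and §1 (p. 1185)] -/
theorem not_exists_unit_multiset_eq_twoPow_furthermore (hn : 2 ≤ n) :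
    ¬∃ u : ZMod (2 ^ n), u.val.Coprime (2 ^ n) ∧
      ({2, ((2 ^ (n - 1) : ℕ) : ZMod (2 ^ n)), ((2 ^ (n - 1) - 2 : ℕ) : ZMod (2 ^ n))} : Multiset (ZMod (2 ^ n))) =
        {u * 1, u * ((2 ^ (n - 1) - 2 : ℕ) : ZMod (2 ^ n)), u * ((2 ^ (n - 1) + 1 : ℕ) : ZMod (2 ^ n))} := by
  rintro ⟨u, hcop, hu⟩
  have hT : 2 ∣ 2 ^ (n - 1) := dvd_pow_self 2 (by omega)
  have hT2 : 2 ∣ 2 ^ (n - 1) - 2 := Nat.dvd_sub hT (dvd_refl 2)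
  have h2 : (2 : ZMod (2 ^ n)) = ((2 : ℕ) : ZMod (2 ^ n)) := (Nat.cast_ofNat).symm
  have h1 : u * 1 ∈ ({2, ((2 ^ (n - 1) : ℕ) : ZMod (2 ^ n)), ((2 ^ (n - 1) - 2 : ℕ) : ZMod (2 ^ n))} : Multiset (ZMod (2 ^ n))) := by
    rw [hu]
    simp
  rw [mul_one] at h1
  simp only [Multiset.insert_eq_cons, Multiset.mem_cons, Multiset.mem_singleton] at h1
  rcases h1 with e | e | e
  · rw [h2] at e
    exact not_coprime_of_eq_natCast_of_two_dvd (by omega) (dvd_refl 2) e hcop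
  · exact not_coprime_of_eq_natCast_of_two_dvd (by omega) hT e hcop
  · exact not_coprime_of_eq_natCast_of_two_dvd (by omega) hT2 e hcop

/-- **… and for the second e)₁ triple**: no unit `u` modulo `2ⁿ` (`n ≥ 2`) has `{2, 2, 2ⁿ − 4} = {u·1, u·(2ⁿ⁻¹ − 2), u·(2ⁿ⁻¹ + 1)}`.
[cite: KoblitzRohrlich1978, Theorem 4 (p. 1186) and §1 (p. 1185)] -/
theorem not_exists_unit_multiset_eq_twoPow_furthermore_snd (hn : 2 ≤ n) :
    ¬∃ u : ZMod (2 ^ n), u.val.Coprime (2 ^ n) ∧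
      ({2, 2, ((2 ^ n - 4 : ℕ) : ZMod (2 ^ n))} : Multiset (ZMod (2 ^ n))) =
        {u * 1, u * ((2 ^ (n - 1) - 2 : ℕ) : ZMod (2 ^ n)), u * ((2 ^ (n - 1) + 1 : ℕ) : ZMod (2 ^ n))} := by
  rintro ⟨u, hcop, hu⟩
  have hN4 : 2 ∣ 2 ^ n - 4 := Nat.dvd_sub (dvd_pow_self 2 (by omega)) (by norm_num)
  have h2 : (2 : ZMod (2 ^ n)) = ((2 : ℕ) : ZMod (2 ^ n)) := (Nat.cast_ofNat).symm
  have h1 : u * 1 ∈ ({2, 2, ((2 ^ n - 4 : ℕ) : ZMod (2 ^ n))} : Multiset (ZMod (2 ^ n))) := by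
    rw [hu]
    simp
  rw [mul_one] at h1
  simp only [Multiset.insert_eq_cons, Multiset.mem_cons, Multiset.mem_singleton] at h1
  rcases h1 with e | e | e
  · rw [h2] at e
    exact not_coprime_of_eq_natCast_of_two_dvd (by omega) (dvd_refl 2) e hcop
  · rw [h2] at e
    exact not_coprime_of_eq_natCast_of_two_dvd (by omega) (dvd_refl 2) e hcop
  · exact not_coprime_of_eq_natCast_of_two_dvd (by omega) hN4 e hcop

end NotObvious

end CyclotomicFermatCMType

end Literature.AlgebraicGeometry.ComplexMultiplication
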